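import Summits.QuantumFields.YangMills.Theorems.TunedSequenceExists.Negative.Freezing
import Summits.QuantumFields.YangMills.Theorems.ParabolicTrajectoryContinuumLimitOnTrajectoryDefsC

/-!
# `ContinuumLimitExists` — negative side I: centred plaquette-string moments FREEZE on a fixed torus

Support file (tightness certificate, part I) for crux `stmt-QuantumFields-16124`
(`Summit.QuantumFields.YangMills.Theses.OneCertifiedCube.ContinuumLimitExists`), line `birth`, lead
prover `prover-line-stmt-QuantumFields-16124-0`, cycle 2 (2026-08-17).

On a FIXED torus of side `2L+1`, for every compact `G` and faithful unitary lattice representation `r`,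
every centred moment of a string of single-plaquette / action-density observables placed at arbitrary
sites tends to `0` as `β → ∞`:
`∫ ∏ᵢ (Oᵢ(τ_{xᵢ} Ũ) − ⟨Oᵢ⟩_{β,2L+1}) dμ_β → 0` (`tendsto_centredMoment`), uniformly over all strings
of length `≤ k` and all positions in `box 4 L` in the sense of ONE eventual threshold
(`eventually_abs_centredMoment_le`). Mechanism: Laplace concentration of Wilson's measure on the flat
configurations (the landed `TunedSequenceExists.Negative.Freezing.tendsto_integral_wilsonMeasure`),
where every plaquette trace is frozen at `N` and the action density at `6N`; a product of centred
bounded factors is bounded by `(2B)^{p-1}` times ONE centred factor, whose `L¹` norm freezes.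

Part II (`OvercooledCanonicalScheme`) turns the thresholds into the over-cooled canonical scheme
(all canonical `n`-point functions tend to `0`), which satisfies every conjunct of the line's
`∃`-stub `stub_uvScheme` except `ND2`/`ND3`, and both `∀`-stub conclusions `Rot345`, `CoreClustering`.
No `sorry`; axioms `propext`, `Classical.choice`, `Quot.sound`.
-/

noncomputable section

open Filter Topology MeasureTheory Finset
open Literature.MathematicalPhysics.QuantumFieldTheory Literature.MathematicalPhysics.QuantumLattice
open Literature.Probability.LatticeModels
open Summit.QuantumFields.YangMills.Cruxes.ContinuumLimitOnTrajectory.TwoOrbitSynchronisation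
open Summit.QuantumFields.YangMills.Theorems.TunedSequenceExists.Negative.Freezing

namespace Summit.QuantumFields.YangMills.Theorems.ContinuumLimitExists.Negative

variable {G : Type} [Group G] [TopologicalSpace G] [IsTopologicalGroup G] [CompactSpace G]
  [MeasurableSpace G] [BorelSpace G]

/-! ## §1 An abstract freezing lemma for products of centred bounded observables -/

omit [TopologicalSpace G] [IsTopologicalGroup G] [CompactSpace G] [MeasurableSpace G] [BorelSpace G] in
/-- Pointwise bound: a product of `p ≥ 1` factors each bounded by `2B` in modulus is at most
`(2B)^{p-1}` times the modulus of the factor `i₀`. -/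
theorem abs_prod_le_pow_mul_abs {p : ℕ} (i₀ : Fin p) (f : Fin p → ℝ) {B : ℝ}
    (hf : ∀ i, |f i| ≤ 2 * B) : |∏ i, f i| ≤ (2 * B) ^ (p - 1) * |f i₀| := by
  have hB : 0 ≤ 2 * B := (abs_nonneg _).trans (hf i₀)
  rw [← Finset.mul_prod_erase Finset.univ f (Finset.mem_univ i₀), abs_mul, mul_comm]
  refine mul_le_mul_of_nonneg_right ?_ (abs_nonneg _)
  rw [Finset.abs_prod]
  calc ∏ i ∈ Finset.univ.erase i₀, |f i| ≤ ∏ _i ∈ Finset.univ.erase i₀, (2 * B) :=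
        Finset.prod_le_prod (fun i _ => abs_nonneg _) fun i _ => hf i
    _ = (2 * B) ^ (p - 1) := by
        rw [Finset.prod_const, Finset.card_erase_of_mem (Finset.mem_univ _), Finset.card_univ,
          Fintype.card_fin]

/-- **Products of centred, bounded, continuous torus observables freeze.** On a fixed torus, if each
`gᵢ` is continuous, bounded by `B`, and constant `= vᵢ` on the flat configurations, and the centring
constants `cᵢ(β)` are bounded by `B` and tend to `vᵢ`, then `∫ ∏ᵢ (gᵢ − cᵢ(β)) dμ_β → 0` as `β → ∞`
(`p ≥ 1`). -/
theorem tendsto_integral_prod_sub [SecondCountableTopology G] {N : ℕ} {S : ℕ} [NeZero S]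
    (ρ : G →* Matrix (Fin N) (Fin N) ℂ) (hρ : Continuous ρ) (hρN : ∀ g, (ρ g).trace.re ≤ N)
    {p : ℕ} (i₀ : Fin p) {g : Fin p → GaugeConfig 4 S G → ℝ} (hg : ∀ i, Continuous (g i))
    {v : Fin p → ℝ} (hv : ∀ i U, wilsonAction ρ U = 0 → g i U = v i)
    {B : ℝ} (hB : ∀ i U, |g i U| ≤ B) {c : Fin p → ℝ → ℝ} (hcB : ∀ i b, |c i b| ≤ B)
    (hc : ∀ i, Tendsto (c i) atTop (𝓝 (v i))) :
    Tendsto (fun b : ℝ => ∫ U, ∏ i, (g i U - c i b) ∂(wilsonMeasure ρ b)) atTop (𝓝 0) := by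
  haveI : ∀ b : ℝ, IsProbabilityMeasure (wilsonMeasure (d := 4) (L := S) (G := G) ρ b) :=
    fun b => isProbabilityMeasure_wilsonMeasure ρ hρ b
  -- the `L¹` norm of ONE centred factor freezes
  have hF : Continuous fun U : GaugeConfig 4 S G => |g i₀ U - v i₀| :=
    continuous_abs.comp ((hg i₀).sub continuous_const)
  have h1 : Tendsto (fun b : ℝ => ∫ U, |g i₀ U - v i₀| ∂(wilsonMeasure ρ b)) atTop (𝓝 0) :=
    tendsto_integral_wilsonMeasure ρ hρ hρN hF (c := 0) fun U hU => by simp [hv i₀ U hU]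
  have h2 : Tendsto (fun b : ℝ => |v i₀ - c i₀ b|) atTop (𝓝 0) := by
    have h2' : Tendsto (fun b : ℝ => v i₀ - c i₀ b) atTop (𝓝 (v i₀ - v i₀)) :=
      tendsto_const_nhds.sub (hc i₀)
    simpa using h2'.abs
  have hbound : Tendsto (fun b : ℝ => (2 * B) ^ (p - 1) *
      (∫ U, |g i₀ U - v i₀| ∂(wilsonMeasure ρ b) + |v i₀ - c i₀ b|)) atTop (𝓝 0) := by
    simpa using (h1.add h2).const_mul ((2 * B) ^ (p - 1))
  refine squeeze_zero_norm (fun b => ?_) hbound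
  rw [Real.norm_eq_abs]
  -- pointwise domination of the product by one factor
  have hptw : ∀ U, |∏ i, (g i U - c i b)| ≤ (2 * B) ^ (p - 1) * |g i₀ U - c i₀ b| := fun U =>
    abs_prod_le_pow_mul_abs i₀ (fun i => g i U - c i b) fun i =>
      (abs_sub _ _).trans (by linarith [hB i U, hcB i b])
  have hB0 : 0 ≤ 2 * B := by
    have := hptw (fun _ => 1)
    exact (abs_nonneg _).trans ((hB i₀ fun _ => 1).trans (by linarith [abs_nonneg (g i₀ fun _ => 1), hB i₀ fun _ => 1]))
  have hint1 : Integrable (fun U => |g i₀ U - c i₀ b|) (wilsonMeasure ρ b) :=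
    integrable_of_continuous _ (continuous_abs.comp ((hg i₀).sub continuous_const))
  have hint2 : Integrable (fun U => |g i₀ U - v i₀|) (wilsonMeasure ρ b) :=
    integrable_of_continuous _ hF
  calc |∫ U, ∏ i, (g i U - c i b) ∂(wilsonMeasure ρ b)|
      ≤ ∫ U, |∏ i, (g i U - c i b)| ∂(wilsonMeasure ρ b) := abs_integral_le_integral_abs
    _ ≤ ∫ U, (2 * B) ^ (p - 1) * |g i₀ U - c i₀ b| ∂(wilsonMeasure ρ b) := by
        refine integral_mono ?_ (hint1.const_mul _) hptw
        exact (integrable_of_continuous _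
          (continuous_finsetProd _ fun i _ => (hg i).sub continuous_const)).abs
    _ = (2 * B) ^ (p - 1) * ∫ U, |g i₀ U - c i₀ b| ∂(wilsonMeasure ρ b) := integral_const_mul _ _
    _ ≤ (2 * B) ^ (p - 1) * (∫ U, |g i₀ U - v i₀| ∂(wilsonMeasure ρ b) + |v i₀ - c i₀ b|) := by
        refine mul_le_mul_of_nonneg_left ?_ (pow_nonneg hB0 _)
        calc ∫ U, |g i₀ U - c i₀ b| ∂(wilsonMeasure ρ b)
            ≤ ∫ U, (|g i₀ U - v i₀| + |v i₀ - c i₀ b|) ∂(wilsonMeasure ρ b) :=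
              integral_mono hint1 (hint2.add (integrable_const _)) fun U => abs_sub_le _ _ _
          _ = ∫ U, |g i₀ U - v i₀| ∂(wilsonMeasure ρ b) + |v i₀ - c i₀ b| := by
              rw [integral_add hint2 (integrable_const _), integral_const]
              simp

/-! ## §2 The observable alphabet: single plaquettes and the action density -/

/-- The alphabet of observables used by the line's vocabulary: `none` ↦ the curvature species
`r.curvature` (Wilson action density), `some q` ↦ the single-plaquette species `plaq r q`. -/
def obsOf (r : LatticeRep G) : Option PlaqIdx → YMSpecies G
  | none => r.curvature
  | some q => plaq r q

/-- Frozen (flat-configuration) values: `6N` for the action density, `N` for a plaquette. -/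
def flatVal (r : LatticeRep G) : Option PlaqIdx → ℝ
  | none => ∑ i : Fin 4, ∑ j : Fin 4, if i < j then (r.N : ℝ) else 0
  | some _ => r.N

/-- Uniform bound `6N` on every letter of the alphabet. -/
theorem abs_obsOf_le (r : LatticeRep G) (s : Option PlaqIdx) (W : LGConfig 4 G) :
    |(obsOf r s).F W| ≤ 6 * r.N := by
  have hN : (0 : ℝ) ≤ r.N := Nat.cast_nonneg _
  -- `|Re tr ρ(g)| ≤ N` for the unitary representation `ρ`
  have abs_re_trace_le : ∀ g : G, |(r.ρ g).trace.re| ≤ r.N := fun g => by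
    have hM := r.mem_unitary g
    calc |(r.ρ g).trace.re| ≤ ‖(r.ρ g).trace‖ := Complex.abs_re_le_norm _
      _ = ‖∑ i, r.ρ g i i‖ := rfl
      _ ≤ ∑ i, ‖r.ρ g i i‖ := norm_sum_le _ _
      _ ≤ ∑ _i : Fin r.N, (1 : ℝ) := Finset.sum_le_sum fun i _ => entry_norm_bound_of_unitary hM i i
      _ = r.N := by simp
  cases s with
  | none =>
    change |actionDensity r.ρ W| ≤ 6 * r.N
    unfold actionDensity
    calc |∑ i : Fin 4, ∑ j : Fin 4, if i < j then plaquetteObs r.ρ 0 i j W else 0|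
        ≤ ∑ i : Fin 4, |∑ j : Fin 4, if i < j then plaquetteObs r.ρ 0 i j W else 0| :=
          Finset.abs_sum_le_sum_abs _ _
      _ ≤ ∑ i : Fin 4, ∑ j : Fin 4, |if i < j then plaquetteObs r.ρ 0 i j W else 0| :=
          Finset.sum_le_sum fun i _ => Finset.abs_sum_le_sum_abs _ _
      _ ≤ ∑ i : Fin 4, ∑ j : Fin 4, (if i < j then (r.N : ℝ) else 0) :=
          Finset.sum_le_sum fun i _ => Finset.sum_le_sum fun j _ => by
            split_ifs with h
            · exact abs_re_trace_le _
            · simp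
      _ = 6 * r.N := by simp [Fin.sum_univ_four]; ring
  | some q =>
    change |plaquetteObs r.ρ 0 q.1.1 q.1.2 W| ≤ 6 * r.N
    exact (abs_re_trace_le _).trans (by linarith)

/-- Every letter, translated and read on the periodic lift, is a continuous function of the torus
configuration. -/
theorem continuous_obsOf_shift_lift (r : LatticeRep G) (s : Option PlaqIdx) (x : Site 4) (S : ℕ) :
    Continuous fun U : GaugeConfig 4 S G => (obsOf r s).F (configShift (-x) (torusLift S U)) := by
  have hlift := (continuous_configShift (G := G) (-x)).comp
    (TunedSequenceExists.Negative.Freezing.continuous_torusLift (G := G) S)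
  cases s with
  | none => exact (continuous_actionDensity r.continuous).comp hlift
  | some q => exact (continuous_plaquetteObs r.ρ r.continuous 0 q.1.1 q.1.2).comp hlift

/-- On flat torus configurations every letter is frozen at its flat value (any translation). -/
theorem obsOf_shift_lift_of_flat (r : LatticeRep G) (s : Option PlaqIdx) (x : Site 4) {S : ℕ} [NeZero S]
    {U : GaugeConfig 4 S G} (hU : wilsonAction r.ρ U = 0) :
    (obsOf r s).F (configShift (-x) (torusLift S U)) = flatVal r s := by
  have hρN : ∀ g, (r.ρ g).trace.re ≤ r.N := fun g => re_trace_le_of_mem_unitaryGroup (r.mem_unitary g)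
  cases s with
  | none => exact actionDensity_configShift_torusLift_eq r.ρ hρN hU (-x)
  | some q =>
    change plaquetteObs r.ρ 0 q.1.1 q.1.2 (configShift (-x) (torusLift S U)) = (r.N : ℝ)
    simp only [plaquetteObs, plaquetteHolonomyZd_configShift, plaquetteHolonomyZd_torusLift']
    exact re_trace_eq_of_wilsonAction_eq_zero r.ρ hρN hU _ _ _ q.2

/-- The untranslated case: `configShift (-0)` is the identity. -/
theorem obsOf_lift_of_flat (r : LatticeRep G) (s : Option PlaqIdx) {S : ℕ} [NeZero S]
    {U : GaugeConfig 4 S G} (hU : wilsonAction r.ρ U = 0) :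
    (obsOf r s).F (torusLift S U) = flatVal r s := by
  have hz : ∀ W : LGConfig 4 G, configShift (0 : Site 4) W = W := fun W => by
    funext e; simp [Literature.MathematicalPhysics.QuantumLattice.configShift_apply]
  have h := obsOf_shift_lift_of_flat r s 0 hU
  rwa [neg_zero, hz] at h

/-! ## §3 Centred moments and their freezing -/

/-- **Centred plaquette-string moment** on the torus of half-side `L` at coupling `β`: the string `σ`
of letters placed at the sites `x`, each centred by its torus Wilson mean —
`∫ ∏ᵢ (O_{σᵢ}(τ_{xᵢ}Ũ) − ⟨O_{σᵢ}⟩_{β,2L+1}) dμ_{β,2L+1}`; these are the coefficients of every canonical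
lattice distribution of the line's vocabulary (`canonDistribution`, `curvDistribution`, `curvNPoint`). -/
def centredMoment (r : LatticeRep G) (L : ℕ) (β : ℝ) (p : ℕ) (σ : Fin p → Option PlaqIdx)
    (x : Fin p → Site 4) : ℝ :=
  ∫ U, ∏ i, ((obsOf r (σ i)).F (configShift (-(x i)) (torusLift (2 * L + 1) U)) -
      wilsonTorusMean r.ρ β L (obsOf r (σ i)).F)
    ∂(wilsonMeasure (d := 4) (L := 2 * L + 1) r.ρ β)

/-- The torus Wilson mean of a letter is bounded by `6N`. -/
theorem abs_wilsonTorusMean_obsOf_le (r : LatticeRep G) (β : ℝ) (L : ℕ) (s : Option PlaqIdx) :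
    |wilsonTorusMean r.ρ β L (obsOf r s).F| ≤ 6 * r.N := by
  haveI : IsProbabilityMeasure (wilsonMeasure (d := 4) (L := 2 * L + 1) (G := G) r.ρ β) :=
    isProbabilityMeasure_wilsonMeasure r.ρ r.continuous β
  unfold wilsonTorusMean
  calc |∫ U, (obsOf r s).F (torusLift (2 * L + 1) U) ∂(wilsonMeasure r.ρ β)|
      ≤ ∫ U, |(obsOf r s).F (torusLift (2 * L + 1) U)| ∂(wilsonMeasure r.ρ β) :=
        abs_integral_le_integral_abs
    _ ≤ ∫ _U, 6 * (r.N : ℝ) ∂(wilsonMeasure (d := 4) (L := 2 * L + 1) r.ρ β) := by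
        refine integral_mono_of_nonneg (ae_of_all _ fun U => abs_nonneg _) (integrable_const _)
          (ae_of_all _ fun U => abs_obsOf_le r s _)
    _ = 6 * r.N := by rw [integral_const]; simp

/-- The torus Wilson mean of a letter freezes at its flat value as `β → ∞`. -/
theorem tendsto_wilsonTorusMean_obsOf (r : LatticeRep G) (L : ℕ) (s : Option PlaqIdx) :
    Tendsto (fun β : ℝ => wilsonTorusMean r.ρ β L (obsOf r s).F) atTop (𝓝 (flatVal r s)) := by
  haveI : SecondCountableTopology G := secondCountable_of_latticeRep r
  have hρN : ∀ g, (r.ρ g).trace.re ≤ r.N := fun g => re_trace_le_of_mem_unitaryGroup (r.mem_unitary g)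
  have hc : Continuous fun U : GaugeConfig 4 (2 * L + 1) G => (obsOf r s).F (torusLift (2 * L + 1) U) := by
    have hz : ∀ W : LGConfig 4 G, configShift (0 : Site 4) W = W := fun W => by
      funext e; simp [Literature.MathematicalPhysics.QuantumLattice.configShift_apply]
    have h := continuous_obsOf_shift_lift r s 0 (2 * L + 1)
    simpa only [neg_zero, hz] using h
  exact tendsto_integral_wilsonMeasure r.ρ r.continuous hρN hc fun U hU => obsOf_lift_of_flat r s hU

/-- **Freezing of centred moments**: on a fixed torus every centred plaquette-string moment of
positive length tends to `0` as `β → ∞`. -/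
theorem tendsto_centredMoment (r : LatticeRep G) (L : ℕ) {p : ℕ} (i₀ : Fin p)
    (σ : Fin p → Option PlaqIdx) (x : Fin p → Site 4) :
    Tendsto (fun β : ℝ => centredMoment r L β p σ x) atTop (𝓝 0) := by
  haveI : SecondCountableTopology G := secondCountable_of_latticeRep r
  have hρN : ∀ g, (r.ρ g).trace.re ≤ r.N := fun g => re_trace_le_of_mem_unitaryGroup (r.mem_unitary g)
  exact tendsto_integral_prod_sub r.ρ r.continuous hρN i₀
    (fun i => continuous_obsOf_shift_lift r (σ i) (x i) (2 * L + 1))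
    (fun i U hU => obsOf_shift_lift_of_flat r (σ i) (x i) hU)
    (fun i U => abs_obsOf_le r (σ i) _) (fun i b => abs_wilsonTorusMean_obsOf_le r b L (σ i))
    (fun i => tendsto_wilsonTorusMean_obsOf r L (σ i))

/-- The finite index of all strings of length `≤ k` over the alphabet with positions in `box 4 L`. -/
abbrev MomentIdx (L k : ℕ) : Type :=
  Σ p : Fin (k + 1), (Fin p → Option PlaqIdx) × (Fin p → ↥(box 4 L))

/-- **One threshold for all short strings**: for every `ε > 0`, eventually in `β`, EVERY centred
moment of length `1 ≤ p ≤ k` over the alphabet, at any positions in `box 4 L`, is at most `ε` in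
modulus (finitely many moments, each frozen). -/
theorem eventually_abs_centredMoment_le (r : LatticeRep G) (L k : ℕ) {ε : ℝ} (hε : 0 < ε) :
    ∀ᶠ β : ℝ in atTop, ∀ p : ℕ, p ≤ k → 1 ≤ p → ∀ (σ : Fin p → Option PlaqIdx) (x : Fin p → ↥(box 4 L)),
      |centredMoment r L β p σ (fun i => (x i : Site 4))| ≤ ε := by
  have hidx : ∀ ι : MomentIdx L k, ∀ᶠ β : ℝ in atTop, 1 ≤ (ι.1 : ℕ) →
      |centredMoment r L β ι.1 ι.2.1 (fun i => (ι.2.2 i : Site 4))| ≤ ε := by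
    rintro ⟨p, σ, x⟩
    by_cases hp : 1 ≤ (p : ℕ)
    · have ht := tendsto_centredMoment r L ⟨0, hp⟩ σ (fun i => (x i : Site 4))
      filter_upwards [(Metric.tendsto_nhds.1 ht) ε hε] with β hβ _
      rw [Real.dist_eq, sub_zero] at hβ
      exact hβ.le
    · exact Eventually.of_forall fun β h => absurd h hp
  filter_upwards [Filter.eventually_all.2 hidx] with β hβ p hpk hp σ x
  exact hβ ⟨⟨p, Nat.lt_succ_of_le hpk⟩, σ, x⟩ hp

end Summit.QuantumFields.YangMills.Theorems.ContinuumLimitExists.Negative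

end
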